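import Summits.QuantumFields.YangMills.Theorems.BalabanUVNodesSpineReadingOfRecord13CoPHKRatioDominationBanked

/-!
# N20 (NE7b) ON THE TOWER-FREE ROAD, END TO END IN PRINT'S CURRENCY: at the CoPHK carriers of record, for ANY bad-key reading, the per-history fibrewise letters with good images (L1),
# the removal data filed under birth slots (b), the banked per-record prices `c r ≤ ρ^{m r}` (R1), the record entropy `Γ^k`, the birth-cell count `V·Λ^a` and the uniform event
# window `N` ⇒ `RelWeightBound 1 … (K ↦ 1 − exp(−S_K))`, `S_K = (Γρ)⁻¹∕(1−Γρ) · V · r^{K − j⋆(K) + 1}∕(1 − r)`, `r = Λ·(Γρ)^{1∕N}` — NO free budget parameter; `r < 1` is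
# `0 < survivalRate p E N L` at `Λ = L⁴`, `Γ = e^{E}`, `ρ = e^{−p}` (`…N20FinalLevelBankedBudget.twoRate_uniformWindow_lt_one_iff`)

Cell `pub-ymgap`, YM-PLAN Track A (HUMAN RULING D-0062); seat `pub-ymgap-dag-n20-d` (R134 (a) N20 NE7b s3 «W_K < 1, Σ W_K < ∞ from [B16] (1.79)–(1.89) pp. 383–387 directly»), gen 40 —
director-ym №374 line (E).  The composition of `…CoPHKRatioDominationBanked.relWeightBound_twoRate_of_fibreDomLetters_banked` (gen 40, p771762) with the stock budget of LINE (E)'s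
SENTENCE `…N20FinalLevelBankedBudget.sum_stock_le_twoRate_of_uniformWindow` (gen 40, p771116): run A's histories live at level `K₀ + K` with the old cut `K₀ + j⋆(K)`, run B's at
`K₀ + K + 1` with the cut `K₀ + j⋆(K) + 1`, so both stocks are bounded by the SAME `S_K`.  `--kind proof --supports stmt-QuantumFields-27366 --as helper` (K3⁸); COUNT-NEUTRAL; THEOREMS ONLY
(0 `def`).  [IV] = [Balaban1989LargeFieldI]; [LF-II] = [Balaban1989LargeFieldII].

WHAT IS PROVED.  `add_sub_add_cut` (the age exponent `(K₀ + K) − (K₀ + j⋆) = K − j⋆`), ★★★ `relWeightBound_uniformWindow_of_fibreDomLetters_banked` (the face with EVERY hypothesis of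
road [e] displayed in print's currency and no free budget; its rate condition `Λ·(Γρ)^{1∕N} < 1` at `Λ = L⁴`, `Γ = e^{E}`, `ρ = e^{−p}` is `0 < survivalRate p E N L` —
`…N20FinalLevelBankedBudget.twoRate_uniformWindow_lt_one_iff ∕ survivalRate_banked_pos_iff`, not restated).

v1.1 (APPEND-ONLY §2; v1 declarations byte-identical): ★ `relWeightBound_uniformWindow_of_fibreDomLetters_banked_bot` — NON-VACUITY GUARD: on the EMPTY bad-key reading (`bd ≡ False`) the
twelve-clause hypothesis package of the face is jointly inhabited by trivial data (identity removal, empty stocks ∕ cells ∕ records, `Λ = 2`, `Γ = 1`, `ρ = 1∕4`, `N_w = 1`, cut `j⋆ ≡ 0`)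
modulo the displayed measurability ∕ integrability provisos, and the face FIRES; no clause contradicts another (in particular the window clause `hwin` against the filing clauses).

HONEST FRAMING.  [bookkeeping].  Displayed hypotheses, each NOT PRINTED as a theorem of [LF-II] for `d = 4` and NOT proved here: (L1) the fibrewise letters hDom (an ESTIMATE — [LF-II]
(1.79)∕(1.89)⁺'s KIND on [IV] (0.3)'s fibre ratio; junction NC-NE7b-α UNRULED); (b) the removal maps with good images, the fibre injections and the slot filing of the stocks (a DEFINER
object on def-T's index, post-campaign design memo per №374); (R1) the banked per-record prices (the cell's banking of print's credits — `…N20BankedTerminalTerm` shows print's (1.80)⁺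
induction tolerates it, [LF-II] itself spends them); the record entropy, the cell count and the uniform window (READING (ID) of `T4PersistentHistoryCount`; print's windows CREEP,
`R_s` of (2.5) [III] — the variable-window budget `sum_stock_le_twoRate_of_records` is the faithful alternative).  NO weight of Bałaban's is bounded, NO estimate proved; NE7 ∕ NE7b ∕ NE7c
NOT PRINTED ∕ NOT proved; no `Provisos₁₃CoPH` inhabitant claimed (K0⁷ OPEN); K3⁸ untouched; N20 NOT discharged; counts UNMOVED (typed 28∕28 · discharged 8∕27); one finite four-torus
programme at fixed `ε` — NOT ℝ⁴, NOT OS, NOT a mass gap, NOT the Clay problem.  No `def`, no `instance`, no `notation`, no `sorry`; no decl below carries a cite tag.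
-/

noncomputable section

open MeasureTheory
open scoped BigOperators
open Finset

namespace YMDAG.UVSplit

open Literature.MathematicalPhysics.QuantumFieldTheory.Balaban1983to89
open Literature.MathematicalPhysics.QuantumFieldTheory.Balaban1983to89.T4Continuum
open Literature.MathematicalPhysics.QuantumFieldTheory.Balaban1983to89.Node00
open Literature.MathematicalPhysics.QuantumFieldTheory.Balaban1983to89.B15.BasicStep (fibreIntegral)
open T4WeightBudget (RelWeightBound)

variable {F : T4Family} {N : ℕ} [NeZero N]

/-- The age exponent is run-independent: `(K₀ + K) − (K₀ + j) = K − j` and `(K₀ + K + 1) − (K₀ + j + 1) = K − j`. [folklore] -/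
theorem add_sub_add_cut (K₀ K j : ℕ) : K₀ + K - (K₀ + j) = K - j ∧ K₀ + K + 1 - (K₀ + j + 1) = K - j := by omega

section Face

variable (θ : Stage13HParams F N) (hP : θ.Provisos₁₃CoPH F N) (K₀ : ℕ) (g₀ : ℕ → ℝ) (os : List (ULoop F))
  (kr : ℕ → (Σ K, SiteSeqKey F (K₀ + K)) → (Σ K, SiteSeqKey F (K₀ + K))) (bd : ℕ → (Σ K, SiteSeqKey F (K₀ + K)) → Prop)

open scoped Classical in
/-- ★★★ **THE N20 FACE ON THE TOWER-FREE ROAD WITH EVERY HYPOTHESIS IN PRINT'S CURRENCY** (any bad-key reading `bd`; constants `V ≥ 0`, `Λ > 0`, `ρ, Γ ≥ 0` with `0 < Γρ < 1`, window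
`N_w > 0`, the rate `Λ·(Γρ)^{1∕N_w} < 1`, an old-scale cut `j⋆(K) ≤ K` keeping a positive fraction of the steps old `c·K ≤ K − j⋆(K)`, birth cells `#Cell a ≤ V·Λ^a`; per `(K, t)`,
`|t| ≤ 1`, EACH RUN: removal map with good images, fibre sets, factors with the fibrewise letter on the bad-key histories, stocks with fibre injections and multiplicative majorants, the
stocks filed under birth slots older than the run's cut (`K₀ + j⋆(K)` for run A at level `K₀ + K`, `K₀ + j⋆(K) + 1` for run B at level `K₀ + K + 1`), records at each slot carrying the
filed activities with banked prices `c ≤ ρ^{m}`, entropy `≤ Γ^{k′}` and `≥ m₀ j` events under the uniform window; displayed measurability ∕ integrability of the dressed pieces) ⇒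
`RelWeightBound 1 (classSetK₁₃ …) (weightAK₁₃ …) (weightBK₁₃ …) (badClassK₁₃ … bd) (K ↦ 1 − exp(−S_K))`, `S_K = (Γρ)⁻¹∕(1−Γρ)·V·r^{K − j⋆(K) + 1}∕(1 − r)`, `r = Λ·(Γρ)^{1∕N_w}`. [bookkeeping] -/
theorem relWeightBound_uniformWindow_of_fibreDomLetters_banked {X γ R : Type*} {V Λ ρ Γ c : ℝ} (hV : 0 ≤ V) (hΛ : 0 < Λ) (hρ : 0 ≤ ρ) (hΓ : 0 ≤ Γ)
    (hq0 : 0 < Γ * ρ) (hq1 : Γ * ρ < 1) {Nw : ℕ} (hN : 0 < Nw) (hr : Λ * (Γ * ρ) ^ ((1 : ℝ) / Nw) < 1) (hc : 0 < c) {jstar : ℕ → ℕ}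
    (hjK : ∀ K, jstar K ≤ K) (hfrac : ∀ K : ℕ, c * K ≤ ((K - jstar K : ℕ) : ℝ)) (Cell : ℕ → Finset γ) (hcell : ∀ a, ((Cell a).card : ℝ) ≤ V * Λ ^ a)
    (hmA : ∀ K t s, Measurable fun V => chiSeqOfRecord F N θ.ν θ.τ9.M (histA₁₃ θ K₀ g₀ K) (K₀ + K) (K₀ + K) s V *
      dressedSlotsOfDatum₉ F N θ.toStage9Params (datumOfRecord₁₃CoPH F N θ hP) g₀ os t (runA₁₃ F K₀ g₀ K) (histA₁₃ θ K₀ g₀ K) (K₀ + K) s V)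
    (hintA : ∀ K t s, Integrable (fun V => chiSeqOfRecord F N θ.ν θ.τ9.M (histA₁₃ θ K₀ g₀ K) (K₀ + K) (K₀ + K) s V *
      dressedSlotsOfDatum₉ F N θ.toStage9Params (datumOfRecord₁₃CoPH F N θ hP) g₀ os t (runA₁₃ F K₀ g₀ K) (histA₁₃ θ K₀ g₀ K) (K₀ + K) s V)
      (fieldMeasure (F.P (K₀ + K)) (K₀ + K) (SU N)))
    (hmB : ∀ K t s', Measurable fun V => chiSeqOfRecord F N θ.ν θ.τ9.M (histB₁₃ θ K₀ g₀ K) (K₀ + K + 1) (K₀ + K + 1) s' V *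
      dressedSlotsOfDatum₉ F N θ.toStage9Params (datumOfRecord₁₃CoPH F N θ hP) g₀ os t (runB₁₃ F K₀ g₀ K) (histB₁₃ θ K₀ g₀ K) (K₀ + K + 1) s' V)
    (hintB : ∀ K t s', Integrable (fun V => chiSeqOfRecord F N θ.ν θ.τ9.M (histB₁₃ θ K₀ g₀ K) (K₀ + K + 1) (K₀ + K + 1) s' V *
      dressedSlotsOfDatum₉ F N θ.toStage9Params (datumOfRecord₁₃CoPH F N θ hP) g₀ os t (runB₁₃ F K₀ g₀ K) (histB₁₃ θ K₀ g₀ K) (K₀ + K + 1) s' V)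
      (fieldMeasure (F.P (K₀ + K + 1)) (K₀ + K + 1) (SU N)))
    (hLA : ∀ (K : ℕ) (t : ℝ), |t| ≤ 1 →
      ∃ (rm : SeqOfRecord F θ.ν θ.τ9.M (histA₁₃ θ K₀ g₀ K) (K₀ + K) (K₀ + K) → SeqOfRecord F θ.ν θ.τ9.M (histA₁₃ θ K₀ g₀ K) (K₀ + K) (K₀ + K))
        (fib : SeqOfRecord F θ.ν θ.τ9.M (histA₁₃ θ K₀ g₀ K) (K₀ + K) (K₀ + K) → Finset (PBond (F.P (K₀ + K)) (K₀ + K)))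
        (z : SeqOfRecord F θ.ν θ.τ9.M (histA₁₃ θ K₀ g₀ K) (K₀ + K) (K₀ + K) → ℝ) (Old : SeqOfRecord F θ.ν θ.τ9.M (histA₁₃ θ K₀ g₀ K) (K₀ + K) (K₀ + K) → Finset X)
        (φ : SeqOfRecord F θ.ν θ.τ9.M (histA₁₃ θ K₀ g₀ K) (K₀ + K) (K₀ + K) → SeqOfRecord F θ.ν θ.τ9.M (histA₁₃ θ K₀ g₀ K) (K₀ + K) (K₀ + K) → Finset X) (x : X → ℝ)
        (slot : SeqOfRecord F θ.ν θ.τ9.M (histA₁₃ θ K₀ g₀ K) (K₀ + K) (K₀ + K) → X → (Σ _ : ℕ, γ))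
        (Rec : SeqOfRecord F θ.ν θ.τ9.M (histA₁₃ θ K₀ g₀ K) (K₀ + K) (K₀ + K) → ℕ → γ → Finset R) (m : ℕ → γ → R → ℕ) (cc : ℕ → γ → R → ℝ) (m₀ : ℕ → ℕ),
        (∀ s, kr K (keyA₁₃ θ K₀ g₀ K s) ∈ badClassK₁₃ θ K₀ g₀ kr bd K t → ∀ V,
          fibreIntegral (fib s) (fun V => chiSeqOfRecord F N θ.ν θ.τ9.M (histA₁₃ θ K₀ g₀ K) (K₀ + K) (K₀ + K) s V *
              dressedSlotsOfDatum₉ F N θ.toStage9Params (datumOfRecord₁₃CoPH F N θ hP) g₀ os t (runA₁₃ F K₀ g₀ K) (histA₁₃ θ K₀ g₀ K) (K₀ + K) s V) V ≤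
            z s * fibreIntegral (fib s) (fun V => chiSeqOfRecord F N θ.ν θ.τ9.M (histA₁₃ θ K₀ g₀ K) (K₀ + K) (K₀ + K) (rm s) V *
              dressedSlotsOfDatum₉ F N θ.toStage9Params (datumOfRecord₁₃CoPH F N θ hP) g₀ os t (runA₁₃ F K₀ g₀ K) (histA₁₃ θ K₀ g₀ K) (K₀ + K) (rm s) V) V) ∧
        (∀ s, kr K (keyA₁₃ θ K₀ g₀ K s) ∈ badClassK₁₃ θ K₀ g₀ kr bd K t → kr K (keyA₁₃ θ K₀ g₀ K (rm s)) ∉ badClassK₁₃ θ K₀ g₀ kr bd K t) ∧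
        (∀ σ, ∀ Y ∈ Old σ, 0 ≤ x Y) ∧
        (∀ σ s, kr K (keyA₁₃ θ K₀ g₀ K s) ∈ badClassK₁₃ θ K₀ g₀ kr bd K t → rm s = σ → φ σ s ⊆ Old σ ∧ (φ σ s).Nonempty) ∧
        (∀ σ, Set.InjOn (φ σ) {s | kr K (keyA₁₃ θ K₀ g₀ K s) ∈ badClassK₁₃ θ K₀ g₀ kr bd K t ∧ rm s = σ}) ∧
        (∀ σ s, kr K (keyA₁₃ θ K₀ g₀ K s) ∈ badClassK₁₃ θ K₀ g₀ kr bd K t → rm s = σ → z s ≤ ∏ Y ∈ φ σ s, x Y) ∧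
        (∀ σ, ∀ Y ∈ Old σ, (slot σ Y).1 < (K₀ + jstar K)) ∧ (∀ σ, ∀ Y ∈ Old σ, (slot σ Y).2 ∈ Cell ((K₀ + K) - (slot σ Y).1)) ∧
        (∀ σ, ∀ j < (K₀ + jstar K), ∀ cz ∈ Cell ((K₀ + K) - j), ∑ Y ∈ Old σ with slot σ Y = ⟨j, cz⟩, x Y ≤ ∑ r ∈ Rec σ j cz, cc j cz r) ∧
        (∀ σ, ∀ j < (K₀ + jstar K), ∀ cz ∈ Cell ((K₀ + K) - j), ∀ r ∈ Rec σ j cz, cc j cz r ≤ ρ ^ m j cz r) ∧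
        (∀ σ, ∀ j < (K₀ + jstar K), ∀ cz ∈ Cell ((K₀ + K) - j), ∀ k', (((Rec σ j cz).filter fun r => m j cz r = k').card : ℝ) ≤ Γ ^ k') ∧
        (∀ σ, ∀ j < (K₀ + jstar K), ∀ cz ∈ Cell ((K₀ + K) - j), ∀ r ∈ Rec σ j cz, m₀ j ≤ m j cz r) ∧
        (∀ j < (K₀ + jstar K), (K₀ + K) + 1 - j ≤ Nw * (m₀ j + 1)))
    (hLB : ∀ (K : ℕ) (t : ℝ), |t| ≤ 1 →
      ∃ (rm : SeqOfRecord F θ.ν θ.τ9.M (histB₁₃ θ K₀ g₀ K) (K₀ + K + 1) (K₀ + K + 1) → SeqOfRecord F θ.ν θ.τ9.M (histB₁₃ θ K₀ g₀ K) (K₀ + K + 1) (K₀ + K + 1))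
        (fib : SeqOfRecord F θ.ν θ.τ9.M (histB₁₃ θ K₀ g₀ K) (K₀ + K + 1) (K₀ + K + 1) → Finset (PBond (F.P (K₀ + K + 1)) (K₀ + K + 1)))
        (z : SeqOfRecord F θ.ν θ.τ9.M (histB₁₃ θ K₀ g₀ K) (K₀ + K + 1) (K₀ + K + 1) → ℝ) (Old : SeqOfRecord F θ.ν θ.τ9.M (histB₁₃ θ K₀ g₀ K) (K₀ + K + 1) (K₀ + K + 1) → Finset X)
        (φ : SeqOfRecord F θ.ν θ.τ9.M (histB₁₃ θ K₀ g₀ K) (K₀ + K + 1) (K₀ + K + 1) → SeqOfRecord F θ.ν θ.τ9.M (histB₁₃ θ K₀ g₀ K) (K₀ + K + 1) (K₀ + K + 1) → Finset X) (x : X → ℝ)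
        (slot : SeqOfRecord F θ.ν θ.τ9.M (histB₁₃ θ K₀ g₀ K) (K₀ + K + 1) (K₀ + K + 1) → X → (Σ _ : ℕ, γ))
        (Rec : SeqOfRecord F θ.ν θ.τ9.M (histB₁₃ θ K₀ g₀ K) (K₀ + K + 1) (K₀ + K + 1) → ℕ → γ → Finset R) (m : ℕ → γ → R → ℕ) (cc : ℕ → γ → R → ℝ) (m₀ : ℕ → ℕ),
        (∀ s', kr K (keyB₁₃ θ K₀ g₀ K s') ∈ badClassK₁₃ θ K₀ g₀ kr bd K t → ∀ V,
          fibreIntegral (fib s') (fun V => chiSeqOfRecord F N θ.ν θ.τ9.M (histB₁₃ θ K₀ g₀ K) (K₀ + K + 1) (K₀ + K + 1) s' V *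
              dressedSlotsOfDatum₉ F N θ.toStage9Params (datumOfRecord₁₃CoPH F N θ hP) g₀ os t (runB₁₃ F K₀ g₀ K) (histB₁₃ θ K₀ g₀ K) (K₀ + K + 1) s' V) V ≤
            z s' * fibreIntegral (fib s') (fun V => chiSeqOfRecord F N θ.ν θ.τ9.M (histB₁₃ θ K₀ g₀ K) (K₀ + K + 1) (K₀ + K + 1) (rm s') V *
              dressedSlotsOfDatum₉ F N θ.toStage9Params (datumOfRecord₁₃CoPH F N θ hP) g₀ os t (runB₁₃ F K₀ g₀ K) (histB₁₃ θ K₀ g₀ K) (K₀ + K + 1) (rm s') V) V) ∧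
        (∀ s', kr K (keyB₁₃ θ K₀ g₀ K s') ∈ badClassK₁₃ θ K₀ g₀ kr bd K t → kr K (keyB₁₃ θ K₀ g₀ K (rm s')) ∉ badClassK₁₃ θ K₀ g₀ kr bd K t) ∧
        (∀ σ, ∀ Y ∈ Old σ, 0 ≤ x Y) ∧
        (∀ σ s', kr K (keyB₁₃ θ K₀ g₀ K s') ∈ badClassK₁₃ θ K₀ g₀ kr bd K t → rm s' = σ → φ σ s' ⊆ Old σ ∧ (φ σ s').Nonempty) ∧
        (∀ σ, Set.InjOn (φ σ) {s' | kr K (keyB₁₃ θ K₀ g₀ K s') ∈ badClassK₁₃ θ K₀ g₀ kr bd K t ∧ rm s' = σ}) ∧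
        (∀ σ s', kr K (keyB₁₃ θ K₀ g₀ K s') ∈ badClassK₁₃ θ K₀ g₀ kr bd K t → rm s' = σ → z s' ≤ ∏ Y ∈ φ σ s', x Y) ∧
        (∀ σ, ∀ Y ∈ Old σ, (slot σ Y).1 < (K₀ + jstar K + 1)) ∧ (∀ σ, ∀ Y ∈ Old σ, (slot σ Y).2 ∈ Cell ((K₀ + K + 1) - (slot σ Y).1)) ∧
        (∀ σ, ∀ j < (K₀ + jstar K + 1), ∀ cz ∈ Cell ((K₀ + K + 1) - j), ∑ Y ∈ Old σ with slot σ Y = ⟨j, cz⟩, x Y ≤ ∑ r ∈ Rec σ j cz, cc j cz r) ∧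
        (∀ σ, ∀ j < (K₀ + jstar K + 1), ∀ cz ∈ Cell ((K₀ + K + 1) - j), ∀ r ∈ Rec σ j cz, cc j cz r ≤ ρ ^ m j cz r) ∧
        (∀ σ, ∀ j < (K₀ + jstar K + 1), ∀ cz ∈ Cell ((K₀ + K + 1) - j), ∀ k', (((Rec σ j cz).filter fun r => m j cz r = k').card : ℝ) ≤ Γ ^ k') ∧
        (∀ σ, ∀ j < (K₀ + jstar K + 1), ∀ cz ∈ Cell ((K₀ + K + 1) - j), ∀ r ∈ Rec σ j cz, m₀ j ≤ m j cz r) ∧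
        (∀ j < (K₀ + jstar K + 1), (K₀ + K + 1) + 1 - j ≤ Nw * (m₀ j + 1))) :
    RelWeightBound 1 (classSetK₁₃ θ K₀ g₀ kr) (weightAK₁₃ θ hP K₀ g₀ os kr) (weightBK₁₃ θ hP K₀ g₀ os kr) (badClassK₁₃ θ K₀ g₀ kr bd)
      (fun K => 1 - Real.exp (-((Γ * ρ)⁻¹ / (1 - Γ * ρ) * V *
        ((Λ * (Γ * ρ) ^ ((1 : ℝ) / Nw)) ^ (K - jstar K + 1) / (1 - Λ * (Γ * ρ) ^ ((1 : ℝ) / Nw)))))) := by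
  have hC : 0 ≤ (Γ * ρ)⁻¹ / (1 - Γ * ρ) := div_nonneg (inv_nonneg.2 hq0.le) (by linarith)
  have hr0 : 0 < Λ * (Γ * ρ) ^ ((1 : ℝ) / Nw) := mul_pos hΛ (Real.rpow_pos_of_pos hq0 _)
  refine relWeightBound_twoRate_of_fibreDomLetters_banked (X := X) θ hP K₀ g₀ os kr bd hC hV hr0 hr hc hfrac hmA hintA hmB hintB ?_ ?_
  · intro K t ht
    obtain ⟨rm, fib, z, Old, φ, x, slot, Rec, m, cc, m₀, hDom, hgood, hx, hφ, hinj, hz, hold, hmem, hfile, hcc, hcount, hmin, hwin⟩ := hLA K t ht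
    refine ⟨rm, fib, z, Old, φ, x, hDom, hgood, hx, hφ, hinj, hz, fun σ => ?_⟩
    have h := sum_stock_le_twoRate_of_uniformWindow (Old σ) (slot σ) x Cell hV hΛ.le hρ hΓ hq0 hq1 hN hr hcell
      (show K₀ + jstar K ≤ K₀ + K from Nat.add_le_add_left (hjK K) K₀) (hold σ) (hmem σ) (Rec σ) m cc m₀ (hfile σ) (hcc σ) (hcount σ) (hmin σ) hwin
    rw [(add_sub_add_cut K₀ K (jstar K)).1] at h
    exact h
  · intro K t ht
    obtain ⟨rm, fib, z, Old, φ, x, slot, Rec, m, cc, m₀, hDom, hgood, hx, hφ, hinj, hz, hold, hmem, hfile, hcc, hcount, hmin, hwin⟩ := hLB K t ht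
    refine ⟨rm, fib, z, Old, φ, x, hDom, hgood, hx, hφ, hinj, hz, fun σ => ?_⟩
    have h := sum_stock_le_twoRate_of_uniformWindow (Old σ) (slot σ) x Cell hV hΛ.le hρ hΓ hq0 hq1 hN hr hcell
      (show K₀ + jstar K + 1 ≤ K₀ + K + 1 from Nat.succ_le_succ (Nat.add_le_add_left (hjK K) K₀)) (hold σ) (hmem σ) (Rec σ) m cc m₀
      (hfile σ) (hcc σ) (hcount σ) (hmin σ) hwin
    rw [(add_sub_add_cut K₀ K (jstar K)).2] at h
    exact h

end Face

/-! ## §2 (v1.1) Non-vacuity guard: the hypothesis package is inhabited on the empty bad-key reading, and the face fires -/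

section Guard

variable (θ : Stage13HParams F N) (hP : θ.Provisos₁₃CoPH F N) (K₀ : ℕ) (g₀ : ℕ → ℝ) (os : List (ULoop F))
  (kr : ℕ → (Σ K, SiteSeqKey F (K₀ + K)) → (Σ K, SiteSeqKey F (K₀ + K)))

open scoped Classical in
/-- ★ **NON-VACUITY GUARD.**  On the EMPTY bad-key reading `bd ≡ False` (so `badClassK₁₃ … = ∅` and every letter ∕ removal ∕ filing clause is about no history) the data `rm = id`,
`fib ≡ ∅`, `z ≡ 0`, empty stocks, `φ ≡ ∅`, `x ≡ 0`, one slot `⟨0, ()⟩`, empty cells and records, `m ≡ 0`, `c ≡ 0`, `m₀ ≡ K₀ + K + 1`, with the numerics `V = 1`, `Λ = 2`, `ρ = 1∕4`,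
`Γ = 1`, `N_w = 1` (`r = 2·(1∕4) = 1∕2 < 1`), `c = 1`, `j⋆ ≡ 0` inhabit ALL hypotheses of `relWeightBound_uniformWindow_of_fibreDomLetters_banked` except the displayed measurability ∕
integrability provisos of the dressed pieces (kept as hypotheses), and the face yields a `RelWeightBound` at the coarse carriers.  A guard against jointly contradictory clauses — nothing
about Bałaban's histories. [bookkeeping] -/
theorem relWeightBound_uniformWindow_of_fibreDomLetters_banked_bot
    (hmA : ∀ K t s, Measurable fun V => chiSeqOfRecord F N θ.ν θ.τ9.M (histA₁₃ θ K₀ g₀ K) (K₀ + K) (K₀ + K) s V *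
      dressedSlotsOfDatum₉ F N θ.toStage9Params (datumOfRecord₁₃CoPH F N θ hP) g₀ os t (runA₁₃ F K₀ g₀ K) (histA₁₃ θ K₀ g₀ K) (K₀ + K) s V)
    (hintA : ∀ K t s, Integrable (fun V => chiSeqOfRecord F N θ.ν θ.τ9.M (histA₁₃ θ K₀ g₀ K) (K₀ + K) (K₀ + K) s V *
      dressedSlotsOfDatum₉ F N θ.toStage9Params (datumOfRecord₁₃CoPH F N θ hP) g₀ os t (runA₁₃ F K₀ g₀ K) (histA₁₃ θ K₀ g₀ K) (K₀ + K) s V)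
      (fieldMeasure (F.P (K₀ + K)) (K₀ + K) (SU N)))
    (hmB : ∀ K t s', Measurable fun V => chiSeqOfRecord F N θ.ν θ.τ9.M (histB₁₃ θ K₀ g₀ K) (K₀ + K + 1) (K₀ + K + 1) s' V *
      dressedSlotsOfDatum₉ F N θ.toStage9Params (datumOfRecord₁₃CoPH F N θ hP) g₀ os t (runB₁₃ F K₀ g₀ K) (histB₁₃ θ K₀ g₀ K) (K₀ + K + 1) s' V)
    (hintB : ∀ K t s', Integrable (fun V => chiSeqOfRecord F N θ.ν θ.τ9.M (histB₁₃ θ K₀ g₀ K) (K₀ + K + 1) (K₀ + K + 1) s' V *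
      dressedSlotsOfDatum₉ F N θ.toStage9Params (datumOfRecord₁₃CoPH F N θ hP) g₀ os t (runB₁₃ F K₀ g₀ K) (histB₁₃ θ K₀ g₀ K) (K₀ + K + 1) s' V)
      (fieldMeasure (F.P (K₀ + K + 1)) (K₀ + K + 1) (SU N))) :
    ∃ W : ℕ → ℝ, RelWeightBound 1 (classSetK₁₃ θ K₀ g₀ kr) (weightAK₁₃ θ hP K₀ g₀ os kr) (weightBK₁₃ θ hP K₀ g₀ os kr) (badClassK₁₃ θ K₀ g₀ kr (fun _ _ => False)) W := by
  have hbadA : ∀ K t s, kr K (keyA₁₃ θ K₀ g₀ K s) ∉ badClassK₁₃ θ K₀ g₀ kr (fun _ _ => False) K t :=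
    fun K t s h => ((mem_badClassK₁₃_iff θ K₀ g₀ kr (fun _ _ => False) K t _).1 h).2
  have hbadB : ∀ K t s', kr K (keyB₁₃ θ K₀ g₀ K s') ∉ badClassK₁₃ θ K₀ g₀ kr (fun _ _ => False) K t :=
    fun K t s' h => ((mem_badClassK₁₃_iff θ K₀ g₀ kr (fun _ _ => False) K t _).1 h).2
  have hq : (1 : ℝ) * (1 / 4) = 1 / 4 := by norm_num
  have hr : (2 : ℝ) * ((1 : ℝ) * (1 / 4)) ^ ((1 : ℝ) / ((1 : ℕ) : ℝ)) < 1 := by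
    rw [Nat.cast_one, div_one, Real.rpow_one]; norm_num
  refine ⟨_, relWeightBound_uniformWindow_of_fibreDomLetters_banked (X := Unit) (γ := Unit) (R := Unit) θ hP K₀ g₀ os kr (fun _ _ => False)
    (V := 1) (Λ := 2) (ρ := 1 / 4) (Γ := 1) (c := 1) zero_le_one two_pos (by norm_num) zero_le_one (by norm_num) (by norm_num) (Nw := 1) one_pos hr one_pos
    (jstar := fun _ => 0) (fun K => Nat.zero_le K) (fun K => by simp) (fun _ => ∅) (fun a => by simp) hmA hintA hmB hintB ?_ ?_⟩
  · intro K t _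
    refine ⟨id, fun _ => ∅, fun _ => 0, fun _ => ∅, fun _ _ => ∅, fun _ => 0, fun _ _ => ⟨0, ()⟩, fun _ _ _ => ∅, fun _ _ _ => 0, fun _ _ _ => 0,
      fun _ => K₀ + K + 1, ?_, ?_, ?_, ?_, ?_, ?_, ?_, ?_, ?_, ?_, ?_, ?_, ?_⟩
    · exact fun s hs => absurd hs (hbadA K t s)
    · exact fun s hs => absurd hs (hbadA K t s)
    · simp
    · exact fun σ s hs => absurd hs (hbadA K t s)
    · exact fun σ s hs => absurd hs.1 (hbadA K t s)
    · exact fun σ s hs => absurd hs (hbadA K t s)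
    · simp
    · simp
    · intro σ j _ cz _; simp
    · intro σ j _ cz _ r hr'; simp at hr'
    · intro σ j _ cz _ k'; simp
    · intro σ j _ cz _ r hr'; simp at hr'
    · intro j _; dsimp only; omega
  · intro K t _
    refine ⟨id, fun _ => ∅, fun _ => 0, fun _ => ∅, fun _ _ => ∅, fun _ => 0, fun _ _ => ⟨0, ()⟩, fun _ _ _ => ∅, fun _ _ _ => 0, fun _ _ _ => 0,
      fun _ => K₀ + K + 1, ?_, ?_, ?_, ?_, ?_, ?_, ?_, ?_, ?_, ?_, ?_, ?_, ?_⟩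
    · exact fun s hs => absurd hs (hbadB K t s)
    · exact fun s hs => absurd hs (hbadB K t s)
    · simp
    · exact fun σ s hs => absurd hs (hbadB K t s)
    · exact fun σ s hs => absurd hs.1 (hbadB K t s)
    · exact fun σ s hs => absurd hs (hbadB K t s)
    · simp
    · simp
    · intro σ j _ cz _; simp
    · intro σ j _ cz _ r hr'; simp at hr'
    · intro σ j _ cz _ k'; simp
    · intro σ j _ cz _ r hr'; simp at hr'
    · intro j _; dsimp only; omega

end Guard

end YMDAG.UVSplit
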